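import Summits.NavierStokesRegularity.NavierStokesRegularity.Theorems.PerpetualPumpCircuitPumpBoot
import Summits.NavierStokesRegularity.NavierStokesRegularity.Theorems.PerpetualPumpCircuitPumpInto
import Summits.NavierStokesRegularity.NavierStokesRegularity.Theorems.PerpetualPumpCircuitPumpCover
import Summits.NavierStokesRegularity.NavierStokesRegularity.Theorems.PerpetualPumpCircuitPumpClockBoxEps
import Summits.NavierStokesRegularity.NavierStokesRegularity.Theorems.PerpetualPumpCircuitPumpActiveZsup
import Summits.NavierStokesRegularity.NavierStokesRegularity.Theorems.PerpetualPumpCircuitPumpBootLemmas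
import Summits.NavierStokesRegularity.NavierStokesRegularity.Theorems.PerpetualPumpCircuitPumpClockBoxTable
import Summits.NavierStokesRegularity.NavierStokesRegularity.Theorems.PerpetualPumpCircuitPumpBoxSection
import Summits.NavierStokesRegularity.NavierStokesRegularity.Theorems.PerpetualPumpCircuitPumpTruncStructure

/-!
# `PerpetualPump.CircuitPump` (stmt-NavierStokesRegularity-1834), line `singular-clock-gspt`:
# stub A — `stub_clockBox`, THE CLOCK BOX, instantiated by the m = 2 seeded graded Toda pump

This file assembles the registered stub `stub_clockBox` (the finite-dimensional Wazewski/clock box with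
its a-priori bound, verbatim as registered by the lead's skeleton) from the landed pieces:

* the instance: the seeded graded Toda table (`toda_isSym`, `toda_isCyc`, `toda_rhsF_zero/one`);
* the parameters: `lam := min ((1+lam₀)/2) (3/2)` and the seed/box constants of `toda_clockBox_eps`;
* the box: amplitude window `[A₁, A₂] = [0.9 A⋆, 1.1 A⋆]` for the active carrier, pinned phase `√ε`
  for the active bond, trail rectangles `[-ρ(n), ρ(n)] × [0, σ(n)]` (`n ≤ -1`), precursor rectangles
  (`n ≥ 1`), all compact convex and containing `0` (`toda_box_section`);
* the window `[T₁(A), T₂(A)]` and its regularity (`toda_clockBox_window`);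
* CoveringHyp (0) = the joint bootstrap `toda_boot`; INTO = `toda_into`; COVER/PHASE = `toda_cover`
  (fed by `toda_boot` on `[0,Tmax]` and the pre-gate sup `toda_active_zsup`).
-/

set_option linter.dupNamespace false

noncomputable section

open Set

namespace Summit.NavierStokesRegularity.NavierStokesRegularity.Theorems.PerpetualPumpCircuitPump

open Summit.NavierStokesRegularity.NavierStokesRegularity.Theorems.CircuitPumpNegative

/-- The choice `lam := min ((1 + lam₀)/2) (3/2)` lies in `(1, lam₀) ∩ (1, 3/2]`. -/
theorem clockBox_lam {lam₀ : ℝ} (h : 1 < lam₀) :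
    1 < min ((1 + lam₀) / 2) (3 / 2) ∧ min ((1 + lam₀) / 2) (3 / 2) < lam₀ ∧
      min ((1 + lam₀) / 2) (3 / 2) ≤ 3 / 2 := by
  refine ⟨lt_min (by linarith) (by norm_num), ?_, min_le_right _ _⟩
  exact lt_of_le_of_lt (min_le_left _ _) (by linarith)

/-- From the crux-style solution clauses (derivative within `Icc 0 S`, right-hand side `rhsF` of the
Toda table) to the hypothesis block of the Toda environment lemmas (continuity on `Icc 0 S`,
right-derivatives on `Ico 0 S` with the displayed Toda equations). -/
theorem clockBox_sol (ε lam S : ℝ) (L : ℕ) (Z : Fin 2 → ℤ → ℝ → ℝ)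
    (coeff : Fin 2 → Fin 2 → Fin 2 → Option (Fin 3) → ℝ)
    (hc : coeff = (fun (i₁ i₂ i₃ : Fin 2) (μ : Option (Fin 3)) => if μ = none then (if i₁ = 1 ∧ i₂ = 1 ∧ i₃ = 0
      then (-1 : ℝ) else if i₁ = 1 ∧ i₂ = 0 ∧ i₃ = 1 then 1 / 2 else if i₁ = 0 ∧ i₂ = 1 ∧ i₃ = 1
      then 1 / 2 else if i₁ = 0 ∧ i₂ = 0 ∧ i₃ = 1 then ε else if i₁ = 0 ∧ i₂ = 1 ∧ i₃ = 0 then -ε /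
      2 else if i₁ = 1 ∧ i₂ = 0 ∧ i₃ = 0 then -ε / 2 else 0) else if μ = some 2 then (if i₁ = 1 ∧
      i₂ = 1 ∧ i₃ = 0 then 1 else 0) else if μ = some 1 then (if i₁ = 1 ∧ i₂ = 0 ∧ i₃ = 1 then -1 /
      2 else 0) else (if i₁ = 0 ∧ i₂ = 1 ∧ i₃ = 1 then -1 / 2 else 0)))
    (hzero : ∀ (i : Fin 2) (n : ℤ), (L : ℤ) < |n| → ∀ t ∈ Set.Icc (0 : ℝ) S, Z i n t = 0)
    (hode : ∀ (i : Fin 2) (n : ℤ), |n| ≤ (L : ℤ) → ∀ t ∈ Set.Icc (0 : ℝ) S,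
      HasDerivWithinAt (Z i n) (rhsF lam coeff Z i n t) (Set.Icc (0 : ℝ) S) t) :
    (∀ n : ℤ, (L : ℤ) < |n| → ∀ t ∈ Set.Icc 0 S, Z 0 n t = 0 ∧ Z 1 n t = 0) ∧
    (∀ n : ℤ, |n| ≤ (L : ℤ) → ContinuousOn (Z 0 n) (Set.Icc 0 S) ∧ ContinuousOn (Z 1 n) (Set.Icc 0 S)) ∧
    (∀ n : ℤ, |n| ≤ (L : ℤ) → ∀ t ∈ Set.Ico 0 S,
      HasDerivWithinAt (Z 0 n) (-(lam ^ ((4 / 5 : ℝ) * n)) * Z 0 n t - lam ^ (n : ℝ) * Z 1 n t ^ 2 + lam ^ ((n : ℝ) - 1) * Z 1 (n - 1) t ^ 2 - ε * lam ^ (n : ℝ) * Z 0 n t * Z 1 n t) (Set.Ici t) t ∧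
      HasDerivWithinAt (Z 1 n) (-(lam ^ ((4 / 5 : ℝ) * n)) * Z 1 n t + lam ^ (n : ℝ) * Z 1 n t * (Z 0 n t - Z 0 (n + 1) t) + ε * lam ^ (n : ℝ) * Z 0 n t ^ 2) (Set.Ici t) t) := by
  subst hc
  refine ⟨fun n hn t ht => ⟨hzero 0 n hn t ht, hzero 1 n hn t ht⟩, fun n hn => ⟨?_, ?_⟩, fun n hn t ht => ⟨?_, ?_⟩⟩
  · exact fun t ht => (hode 0 n hn t ht).continuousWithinAt
  · exact fun t ht => (hode 1 n hn t ht).continuousWithinAt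
  · have h := (hode 0 n hn t ⟨ht.1, ht.2.le⟩).mono_of_mem_nhdsWithin
      (Filter.mem_of_superset (Icc_mem_nhdsGE ht.2) (Icc_subset_Icc_left ht.1))
    rw [toda_rhsF_zero] at h
    exact h
  · have h := (hode 1 n hn t ⟨ht.1, ht.2.le⟩).mono_of_mem_nhdsWithin
      (Filter.mem_of_superset (Icc_mem_nhdsGE ht.2) (Icc_subset_Icc_left ht.1))
    rw [toda_rhsF_one] at h
    exact h

/-- The trail/precursor rectangles of the clock box are compact, convex, nonempty and contain `0`. -/
theorem clockBox_boxes (lam r ε A₁ Tmax : ℝ) (hlam : 1 < lam) (hε : 0 < ε) (hA₁ : 0 < A₁) :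
    ∀ n : ℤ, (IsCompact ((fun n : ℤ => if n < 0 then {y : Fin 2 → ℝ | -(13 * lam ^ (-(n : ℝ) / 5) * (2 - lam ^ ((4 / 5 : ℝ) * n))) ≤ y 0 ∧ y 0 ≤ 13 * lam ^ (-(n : ℝ) / 5) * (2 - lam ^ ((4 / 5 : ℝ) * n)) ∧ 0 ≤ y 1 ∧ y 1 ≤ 40 / A₁ * lam ^ (-(n : ℝ) / 5) * Real.exp ((65 + 169 / 10 * ε * A₁) * Tmax * (1 - lam ^ ((4 / 5 : ℝ) * (n + 1))) / (1 - r))}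
      else if n = 1 then {y : Fin 2 → ℝ | -ε ^ 2 ≤ y 0 ∧ y 0 ≤ ε ^ (3 / 4 : ℝ) ∧ 0 ≤ y 1 ∧ y 1 ≤ ε ^ (3 / 2 : ℝ)}
      else {y : Fin 2 → ℝ | -(ε ^ 2 * (2 * lam) ^ (-(n : ℝ))) ≤ y 0 ∧ y 0 ≤ ε ^ 2 * (2 * lam) ^ (-(n : ℝ)) ∧ 0 ≤ y 1 ∧
        y 1 ≤ ε ^ (3 / 2 : ℝ) * (2 * lam) ^ (-(n : ℝ))}) n) ∧ Convex ℝ ((fun n : ℤ => if n < 0 then {y : Fin 2 → ℝ | -(13 * lam ^ (-(n : ℝ) / 5) * (2 - lam ^ ((4 / 5 : ℝ) * n))) ≤ y 0 ∧ y 0 ≤ 13 * lam ^ (-(n : ℝ) / 5) * (2 - lam ^ ((4 / 5 : ℝ) * n)) ∧ 0 ≤ y 1 ∧ y 1 ≤ 40 / A₁ * lam ^ (-(n : ℝ) / 5) * Real.exp ((65 + 169 / 10 * ε * A₁) * Tmax * (1 - lam ^ ((4 / 5 : ℝ) * (n + 1))) / (1 - r))}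
      else if n = 1 then {y : Fin 2 → ℝ | -ε ^ 2 ≤ y 0 ∧ y 0 ≤ ε ^ (3 / 4 : ℝ) ∧ 0 ≤ y 1 ∧ y 1 ≤ ε ^ (3 / 2 : ℝ)}
      else {y : Fin 2 → ℝ | -(ε ^ 2 * (2 * lam) ^ (-(n : ℝ))) ≤ y 0 ∧ y 0 ≤ ε ^ 2 * (2 * lam) ^ (-(n : ℝ)) ∧ 0 ≤ y 1 ∧
        y 1 ≤ ε ^ (3 / 2 : ℝ) * (2 * lam) ^ (-(n : ℝ))}) n) ∧ ((fun n : ℤ => if n < 0 then {y : Fin 2 → ℝ | -(13 * lam ^ (-(n : ℝ) / 5) * (2 - lam ^ ((4 / 5 : ℝ) * n))) ≤ y 0 ∧ y 0 ≤ 13 * lam ^ (-(n : ℝ) / 5) * (2 - lam ^ ((4 / 5 : ℝ) * n)) ∧ 0 ≤ y 1 ∧ y 1 ≤ 40 / A₁ * lam ^ (-(n : ℝ) / 5) * Real.exp ((65 + 169 / 10 * ε * A₁) * Tmax * (1 - lam ^ ((4 / 5 : ℝ) * (n + 1))) / (1 - r))}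
      else if n = 1 then {y : Fin 2 → ℝ | -ε ^ 2 ≤ y 0 ∧ y 0 ≤ ε ^ (3 / 4 : ℝ) ∧ 0 ≤ y 1 ∧ y 1 ≤ ε ^ (3 / 2 : ℝ)}
      else {y : Fin 2 → ℝ | -(ε ^ 2 * (2 * lam) ^ (-(n : ℝ))) ≤ y 0 ∧ y 0 ≤ ε ^ 2 * (2 * lam) ^ (-(n : ℝ)) ∧ 0 ≤ y 1 ∧
        y 1 ≤ ε ^ (3 / 2 : ℝ) * (2 * lam) ^ (-(n : ℝ))}) n).Nonempty) ∧
      (fun _ : Fin 2 => (0 : ℝ)) ∈ (fun n : ℤ => if n < 0 then {y : Fin 2 → ℝ | -(13 * lam ^ (-(n : ℝ) / 5) * (2 - lam ^ ((4 / 5 : ℝ) * n))) ≤ y 0 ∧ y 0 ≤ 13 * lam ^ (-(n : ℝ) / 5) * (2 - lam ^ ((4 / 5 : ℝ) * n)) ∧ 0 ≤ y 1 ∧ y 1 ≤ 40 / A₁ * lam ^ (-(n : ℝ) / 5) * Real.exp ((65 + 169 / 10 * ε * A₁) * Tmax * (1 - lam ^ ((4 / 5 : ℝ) * (n + 1)))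 / (1 - r))}
      else if n = 1 then {y : Fin 2 → ℝ | -ε ^ 2 ≤ y 0 ∧ y 0 ≤ ε ^ (3 / 4 : ℝ) ∧ 0 ≤ y 1 ∧ y 1 ≤ ε ^ (3 / 2 : ℝ)}
      else {y : Fin 2 → ℝ | -(ε ^ 2 * (2 * lam) ^ (-(n : ℝ))) ≤ y 0 ∧ y 0 ≤ ε ^ 2 * (2 * lam) ^ (-(n : ℝ)) ∧ 0 ≤ y 1 ∧
        y 1 ≤ ε ^ (3 / 2 : ℝ) * (2 * lam) ^ (-(n : ℝ))}) n := by
  intro n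
  have hlam0 : 0 < lam := by linarith
  by_cases hn : n < 0
  · simp only [hn, if_true]
    have hρ : 0 ≤ 13 * lam ^ (-(n : ℝ) / 5) * (2 - lam ^ ((4 / 5 : ℝ) * n)) := by
      have h1 : lam ^ ((4 / 5 : ℝ) * n) ≤ 1 :=
        Real.rpow_le_one_of_one_le_of_nonpos hlam.le
          (mul_nonpos_of_nonneg_of_nonpos (by norm_num) (by exact_mod_cast hn.le))
      have h2 : 0 ≤ lam ^ (-(n : ℝ) / 5) := (Real.rpow_pos_of_pos hlam0 _).le
      nlinarith
    have hσ : 0 ≤ 40 / A₁ * lam ^ (-(n : ℝ) / 5) * Real.exp ((65 + 169 / 10 * ε * A₁) * Tmax * (1 - lam ^ ((4 / 5 : ℝ) * (n + 1))) / (1 - r)) := by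
      have h2 : 0 ≤ lam ^ (-(n : ℝ) / 5) := (Real.rpow_pos_of_pos hlam0 _).le
      exact mul_nonneg (mul_nonneg (div_nonneg (by norm_num) hA₁.le) h2) (Real.exp_pos _).le
    have := toda_box_section (-(13 * lam ^ (-(n : ℝ) / 5) * (2 - lam ^ ((4 / 5 : ℝ) * n)))) (13 * lam ^ (-(n : ℝ) / 5) * (2 - lam ^ ((4 / 5 : ℝ) * n))) (40 / A₁ * lam ^ (-(n : ℝ) / 5) * Real.exp ((65 + 169 / 10 * ε * A₁) * Tmax * (1 - lam ^ ((4 / 5 : ℝ) * (n + 1))) / (1 - r))) (by linarith) hρ hσ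
    exact ⟨⟨this.1, this.2.1, this.2.2.1⟩, this.2.2.2⟩
  · simp only [hn, if_false]
    by_cases h1 : n = 1
    · simp only [h1, if_true]
      have := toda_box_section (-ε ^ 2) (ε ^ (3 / 4 : ℝ)) (ε ^ (3 / 2 : ℝ))
        (by nlinarith [sq_nonneg ε]) (Real.rpow_pos_of_pos hε _).le (Real.rpow_pos_of_pos hε _).le
      exact ⟨⟨this.1, this.2.1, this.2.2.1⟩, this.2.2.2⟩
    · simp only [h1, if_false]
      have hp : 0 < (2 * lam) ^ (-(n : ℝ)) := Real.rpow_pos_of_pos (by linarith) _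
      have ha : 0 ≤ ε ^ 2 * (2 * lam) ^ (-(n : ℝ)) := by positivity
      have hb : 0 ≤ ε ^ (3 / 2 : ℝ) * (2 * lam) ^ (-(n : ℝ)) :=
        mul_nonneg (Real.rpow_pos_of_pos hε _).le hp.le
      have := toda_box_section (-(ε ^ 2 * (2 * lam) ^ (-(n : ℝ)))) (ε ^ 2 * (2 * lam) ^ (-(n : ℝ)))
        (ε ^ (3 / 2 : ℝ) * (2 * lam) ^ (-(n : ℝ))) (by linarith) ha hb
      exact ⟨⟨this.1, this.2.1, this.2.2.1⟩, this.2.2.2⟩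


/-- The box data, unpacked: from membership of the scale-`0` datum in `[A₁,A₂] × {√ε}` and of the
other data in the rectangles `Q n`, the data hypotheses of `toda_boot` / `toda_into` / `toda_cover`. -/
theorem clockBox_data (lam r ε A₁ A₂ Tmax : ℝ) (x : Fin 2 → ℤ → ℝ) (Z : Fin 2 → ℤ → ℝ → ℝ)
    (hbox0 : ∀ i : Fin 2, (fun i : Fin 2 => if i = 0 then A₁ else Real.sqrt ε) i ≤ x i 0 ∧ x i 0 ≤ (fun i : Fin 2 => if i = 0 then A₂ else Real.sqrt ε) i)
    (hboxQ : ∀ n : ℤ, n ≠ 0 → (fun i => x i n) ∈ (fun n : ℤ => if n < 0 then {y : Fin 2 → ℝ | -(13 * lam ^ (-(n : ℝ) / 5) * (2 - lam ^ ((4 / 5 : ℝ) * n))) ≤ y 0 ∧ y 0 ≤ 13 * lam ^ (-(n : ℝ) / 5) * (2 - lam ^ ((4 / 5 : ℝ) * n)) ∧ 0 ≤ y 1 ∧ y 1 ≤ 40 / A₁ * lam ^ (-(n : ℝ) / 5) * Real.exp ((65 + 169 / 10 * ε * A₁) * Tmax * (1 - lam ^ ((4 / 5 : ℝ) * (n +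 1))) / (1 - r))}
      else if n = 1 then {y : Fin 2 → ℝ | -ε ^ 2 ≤ y 0 ∧ y 0 ≤ ε ^ (3 / 4 : ℝ) ∧ 0 ≤ y 1 ∧ y 1 ≤ ε ^ (3 / 2 : ℝ)}
      else {y : Fin 2 → ℝ | -(ε ^ 2 * (2 * lam) ^ (-(n : ℝ))) ≤ y 0 ∧ y 0 ≤ ε ^ 2 * (2 * lam) ^ (-(n : ℝ)) ∧ 0 ≤ y 1 ∧
        y 1 ≤ ε ^ (3 / 2 : ℝ) * (2 * lam) ^ (-(n : ℝ))}) n)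
    (hinit : ∀ (i : Fin 2) (n : ℤ), Z i n 0 = x i n) :
    x 1 0 = Real.sqrt ε ∧
    Z 0 0 0 = x 0 0 ∧ A₁ ≤ x 0 0 ∧ x 0 0 ≤ A₂ ∧ Z 1 0 0 = Real.sqrt ε ∧ -ε ^ 2 ≤ Z 0 1 0 ∧
    Z 0 1 0 ≤ ε ^ (3 / 4 : ℝ) ∧ 0 ≤ Z 1 1 0 ∧ Z 1 1 0 ≤ ε ^ (3 / 2 : ℝ) ∧ (∀ n : ℤ, 0 ≤ Z 1 n 0) ∧
    (∀ n : ℤ, 2 ≤ n → |Z 0 n 0| ≤ ε ^ 2 * (2 * lam) ^ (-(n : ℝ)) ∧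
      Z 1 n 0 ≤ ε ^ (3 / 2 : ℝ) * (2 * lam) ^ (-(n : ℝ))) ∧
    (∀ n : ℤ, n ≤ -1 → |Z 0 n 0| ≤ 13 * lam ^ (-(n : ℝ) / 5) * (2 - lam ^ ((4 / 5 : ℝ) * n)) ∧
      Z 1 n 0 ≤ 40 / A₁ * lam ^ (-(n : ℝ) / 5) * Real.exp ((65 + 169 / 10 * ε * A₁) * Tmax * (1 - lam ^ ((4 / 5 : ℝ) * (n + 1))) / (1 - r))) := by
  have h0 : A₁ ≤ x 0 0 ∧ x 0 0 ≤ A₂ := hbox0 0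
  have h1 : Real.sqrt ε ≤ x 1 0 ∧ x 1 0 ≤ Real.sqrt ε := hbox0 1
  have hx1 : x 1 0 = Real.sqrt ε := le_antisymm h1.2 h1.1
  have hQ1 : -ε ^ 2 ≤ x 0 1 ∧ x 0 1 ≤ ε ^ (3 / 4 : ℝ) ∧ 0 ≤ x 1 1 ∧ x 1 1 ≤ ε ^ (3 / 2 : ℝ) := by
    exact hboxQ 1 one_ne_zero
  have hQp : ∀ n : ℤ, 2 ≤ n → -(ε ^ 2 * (2 * lam) ^ (-(n : ℝ))) ≤ x 0 n ∧ x 0 n ≤ ε ^ 2 * (2 * lam) ^ (-(n : ℝ)) ∧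
      0 ≤ x 1 n ∧ x 1 n ≤ ε ^ (3 / 2 : ℝ) * (2 * lam) ^ (-(n : ℝ)) := by
    intro n hn
    have h := hboxQ n (by omega)
    simp only [show ¬ (n < 0) from by omega, show ¬ (n = 1) from by omega, ↓reduceIte,
      Set.mem_setOf_eq] at h
    exact h
  have hQt : ∀ n : ℤ, n ≤ -1 → -(13 * lam ^ (-(n : ℝ) / 5) * (2 - lam ^ ((4 / 5 : ℝ) * n))) ≤ x 0 n ∧ x 0 n ≤ 13 * lam ^ (-(n : ℝ) / 5) * (2 - lam ^ ((4 / 5 : ℝ) * n)) ∧ 0 ≤ x 1 n ∧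
      x 1 n ≤ 40 / A₁ * lam ^ (-(n : ℝ) / 5) * Real.exp ((65 + 169 / 10 * ε * A₁) * Tmax * (1 - lam ^ ((4 / 5 : ℝ) * (n + 1))) / (1 - r)) := by
    intro n hn
    have h := hboxQ n (by omega)
    simp only [show n < 0 from by omega, ↓reduceIte, Set.mem_setOf_eq] at h
    exact h
  refine ⟨hx1, hinit 0 0, h0.1, h0.2, by rw [hinit, hx1], by rw [hinit]; exact hQ1.1,
    by rw [hinit]; exact hQ1.2.1, by rw [hinit]; exact hQ1.2.2.1, by rw [hinit]; exact hQ1.2.2.2,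
    ?_, ?_, ?_⟩
  · intro n
    rw [hinit]
    rcases lt_trichotomy n 0 with hn | rfl | hn
    · exact (hQt n (by omega)).2.2.1
    · rw [hx1]; exact Real.sqrt_nonneg ε
    · by_cases hn1 : n = 1
      · subst hn1; exact hQ1.2.2.1
      · exact (hQp n (by omega)).2.2.1
  · intro n hn
    rw [hinit, hinit]
    exact ⟨abs_le.2 ⟨(hQp n hn).1, (hQp n hn).2.1⟩, (hQp n hn).2.2.2⟩
  · intro n hn
    rw [hinit, hinit]
    exact ⟨abs_le.2 ⟨(hQt n hn).1, (hQt n hn).2.1⟩, (hQt n hn).2.2.2⟩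

/-- **Stub A (`ClockBox`) — the Toda instance closes it.** See the module docstring. -/
theorem stub_clockBox :
    ∀ lam₀ : ℝ, 1 < lam₀ → ∃ lam : ℝ, 1 < lam ∧ lam < lam₀ ∧
    ∃ (m : ℕ) (coeff : Fin m → Fin m → Fin m → Option (Fin 3) → ℝ),
      Summit.NavierStokesRegularity.NavierStokesRegularity.Theorems.CircuitPumpNegative.IsSym coeff ∧
      Summit.NavierStokesRegularity.NavierStokesRegularity.Theorems.CircuitPumpNegative.IsCyc coeff ∧
      ∃ (lo hi : Fin m → ℝ) (Q : ℤ → Set (Fin m → ℝ)) (ia ip : Fin m) (T₁ T₂ : ℝ → ℝ)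
        (C Tmin Tmax : ℝ) (L₀ : ℕ),
        ia ≠ ip ∧ 1 ≤ L₀ ∧
        ((∀ i : Fin m, lo i ≤ hi i) ∧
          (∀ n : ℤ, n ≠ 0 → IsCompact (Q n) ∧ Convex ℝ (Q n) ∧ (Q n).Nonempty) ∧
          (∀ n : ℤ, (L₀ : ℤ) < |n| → (fun _ : Fin m => (0 : ℝ)) ∈ Q n)) ∧
        0 < lo ia ∧
        (ContinuousOn T₁ (Set.Icc (lo ia) (hi ia)) ∧ ContinuousOn T₂ (Set.Icc (lo ia) (hi ia)) ∧ 0 < Tmin ∧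
          ∀ A ∈ Set.Icc (lo ia) (hi ia), Tmin ≤ T₁ A ∧ T₁ A ≤ T₂ A ∧ T₂ A ≤ Tmax) ∧
        ∀ L : ℕ, L₀ ≤ L →
          ∀ x : Fin m → ℤ → ℝ,
            ((∀ i : Fin m, lo i ≤ x i 0 ∧ x i 0 ≤ hi i) ∧ ∀ n : ℤ, n ≠ 0 → (fun i => x i n) ∈ Q n) →
            (∀ (i : Fin m) (n : ℤ), (L : ℤ) < |n| → x i n = 0) →
            (∀ (T' : ℝ) (Z : Fin m → ℤ → ℝ → ℝ), 0 < T' → T' ≤ Tmax →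
                ((∀ (i : Fin m) (n : ℤ), Z i n 0 = x i n) ∧
                  (∀ (i : Fin m) (n : ℤ), (L : ℤ) < |n| → ∀ t ∈ Set.Icc (0 : ℝ) T', Z i n t = 0) ∧
                  (∀ (i : Fin m) (n : ℤ), |n| ≤ (L : ℤ) → ∀ t ∈ Set.Icc (0 : ℝ) T',
                    HasDerivWithinAt (Z i n)
                      (Summit.NavierStokesRegularity.NavierStokesRegularity.Theorems.CircuitPumpNegative.rhsF
                        lam coeff Z i n t) (Set.Icc (0 : ℝ) T') t)) →
                ∀ (i : Fin m) (n : ℤ), ∀ t ∈ Set.Icc (0 : ℝ) T', lam ^ ((3 / 5 : ℝ) * n) * |Z i n t| ≤ C) ∧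
            (∀ Z : Fin m → ℤ → ℝ → ℝ,
              ((∀ (i : Fin m) (n : ℤ), Z i n 0 = x i n) ∧
                (∀ (i : Fin m) (n : ℤ), (L : ℤ) < |n| → ∀ t ∈ Set.Icc (0 : ℝ) Tmax, Z i n t = 0) ∧
                (∀ (i : Fin m) (n : ℤ), |n| ≤ (L : ℤ) → ∀ t ∈ Set.Icc (0 : ℝ) Tmax,
                  HasDerivWithinAt (Z i n)
                    (Summit.NavierStokesRegularity.NavierStokesRegularity.Theorems.CircuitPumpNegative.rhsF
                      lam coeff Z i n t) (Set.Icc (0 : ℝ) Tmax) t)) →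
              (∀ T ∈ Set.Icc (T₁ (x ia 0)) (T₂ (x ia 0)),
                  (∀ n : ℤ, n ≠ 0 → |n| ≤ (L : ℤ) →
                    (fun i => lam ^ (1 / 5 : ℝ) * Z i (n + 1) T) ∈ Q n) ∧
                  (∀ i : Fin m, i ≠ ia → i ≠ ip →
                    lo i ≤ lam ^ (1 / 5 : ℝ) * Z i 1 T ∧ lam ^ (1 / 5 : ℝ) * Z i 1 T ≤ hi i)) ∧
              (∀ T ∈ Set.Icc (T₁ (x ia 0)) (T₂ (x ia 0)), lam ^ (1 / 5 : ℝ) * Z ip 1 T = x ip 0 →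
                  (x ia 0 = lo ia → lam ^ (1 / 5 : ℝ) * Z ia 1 T < lo ia) ∧
                  (x ia 0 = hi ia → hi ia < lam ^ (1 / 5 : ℝ) * Z ia 1 T)) ∧
              (lam ^ (1 / 5 : ℝ) * Z ip 1 (T₁ (x ia 0)) < x ip 0 ∧
                x ip 0 < lam ^ (1 / 5 : ℝ) * Z ip 1 (T₂ (x ia 0)))) := by
  intro lam₀ hlam₀
  obtain ⟨hlam1, hlamlt, hlam32⟩ := clockBox_lam hlam₀
  generalize min ((1 + lam₀) / 2) (3 / 2) = lam at hlam1 hlamlt hlam32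
  obtain ⟨ν, q, r, ε, Λ, As, A₁, A₂, Tmax, hν, hq, hr, hε, hΛ, hAs, hA₁, hA₂, h4, hbig, hTmax, hε5, hs2,
    hs3, hs5, hsσ, hs6, hs7⟩ := toda_clockBox_eps lam hlam1 hlam32
  subst hν hq hr hΛ
  have hwin := toda_clockBox_window lam (lam ^ (4 / 5 : ℝ)) (lam ^ (1 / 5 : ℝ)) ε (-Real.log ε) As A₁ A₂
    hlam1 hlam32 rfl rfl hε rfl hAs hA₁ hA₂ h4 hbig
  rw [← hTmax] at hwin
  obtain ⟨⟨hc1, hc2⟩, hTmin, hT8, hchain, hpt⟩ := hwin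
  have hAs0 : 0 < As := by have h := h4; rw [hA₁] at h; linarith
  have hA₁0 : 0 < A₁ := by linarith
  have hA12 : A₁ ≤ A₂ := by rw [hA₁, hA₂]; linarith
  have hTmax0 : 0 < Tmax := by
    have h := hchain A₁ ⟨le_rfl, hA12⟩
    linarith [h.1, h.2.1, h.2.2]
  refine ⟨lam, hlam1, hlamlt, 2,
    (fun (i₁ i₂ i₃ : Fin 2) (μ : Option (Fin 3)) => if μ = none then (if i₁ = 1 ∧ i₂ = 1 ∧ i₃ = 0
      then (-1 : ℝ) else if i₁ = 1 ∧ i₂ = 0 ∧ i₃ = 1 then 1 / 2 else if i₁ = 0 ∧ i₂ = 1 ∧ i₃ = 1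
      then 1 / 2 else if i₁ = 0 ∧ i₂ = 0 ∧ i₃ = 1 then ε else if i₁ = 0 ∧ i₂ = 1 ∧ i₃ = 0 then -ε /
      2 else if i₁ = 1 ∧ i₂ = 0 ∧ i₃ = 0 then -ε / 2 else 0) else if μ = some 2 then (if i₁ = 1 ∧
      i₂ = 1 ∧ i₃ = 0 then 1 else 0) else if μ = some 1 then (if i₁ = 1 ∧ i₂ = 0 ∧ i₃ = 1 then -1 /
      2 else 0) else (if i₁ = 0 ∧ i₂ = 1 ∧ i₃ = 1 then -1 / 2 else 0)),
    toda_isSym ε, toda_isCyc ε,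
    (fun i : Fin 2 => if i = 0 then A₁ else Real.sqrt ε), (fun i : Fin 2 => if i = 0 then A₂ else Real.sqrt ε),
    (fun n : ℤ => if n < 0 then {y : Fin 2 → ℝ | -(13 * lam ^ (-(n : ℝ) / 5) * (2 - lam ^ ((4 / 5 : ℝ) * n))) ≤ y 0 ∧ y 0 ≤ 13 * lam ^ (-(n : ℝ) / 5) * (2 - lam ^ ((4 / 5 : ℝ) * n)) ∧ 0 ≤ y 1 ∧ y 1 ≤ 40 / A₁ * lam ^ (-(n : ℝ) / 5) * Real.exp ((65 + 169 / 10 * ε * A₁) * Tmax * (1 - lam ^ ((4 / 5 : ℝ) * (n + 1))) / (1 - lam ^ (-(4 / 5 : ℝ))))}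
      else if n = 1 then {y : Fin 2 → ℝ | -ε ^ 2 ≤ y 0 ∧ y 0 ≤ ε ^ (3 / 4 : ℝ) ∧ 0 ≤ y 1 ∧ y 1 ≤ ε ^ (3 / 2 : ℝ)}
      else {y : Fin 2 → ℝ | -(ε ^ 2 * (2 * lam) ^ (-(n : ℝ))) ≤ y 0 ∧ y 0 ≤ ε ^ 2 * (2 * lam) ^ (-(n : ℝ)) ∧ 0 ≤ y 1 ∧
        y 1 ≤ ε ^ (3 / 2 : ℝ) * (2 * lam) ^ (-(n : ℝ))}),
    0, 1, (fun A : ℝ => (((-Real.log (1 - (((-Real.log ε) / 2 + Real.log (A / 8)) + 11 / 5) / A)) + (250 + 16 * Real.log A) / A) + (-(1 / lam ^ (4 / 5 : ℝ)) * Real.log (1 - lam ^ (4 / 5 : ℝ) * ((-Real.log ε) / 2 - Real.log (lam ^ (1 / 5 : ℝ)) - 28 * Real.log A - 449) / (lam * (A - ((-Real.log ε) / 2 + Real.log (A / 8)) + 903 + 50 * Real.log A)))))), (fun A : ℝ => (((-Real.log (1 - (((-Real.log ε) / 2 + Real.log (A / 8)) + 11 / 5) / A)) + (250 + 16 * Real.log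 A) / A) + (-(1 / lam ^ (4 / 5 : ℝ)) * Real.log (1 - lam ^ (4 / 5 : ℝ) * ((-Real.log ε) / 2 - Real.log (lam ^ (1 / 5 : ℝ)) + 73) / (lam * (A - ((-Real.log ε) / 2 + Real.log (A / 8)) - 903 - 50 * Real.log A)))))),
    lam ^ (3 / 5 : ℝ) * (A₂ + 3) + 30, 250 / A₂, Tmax, 2, by decide, by norm_num, ?_, ?_, ?_, ?_⟩
  · -- BoxOK
    refine ⟨?_, fun n _ => (clockBox_boxes lam (lam ^ (-(4 / 5 : ℝ))) ε A₁ Tmax hlam1 hε hA₁0 n).1,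
      fun n _ => (clockBox_boxes lam (lam ^ (-(4 / 5 : ℝ))) ε A₁ Tmax hlam1 hε hA₁0 n).2⟩
    intro i
    rcases fin_two_eq_zero_or_one i with rfl | rfl
    · show A₁ ≤ A₂
      exact hA12
    · show Real.sqrt ε ≤ Real.sqrt ε
      exact le_rfl
  · -- 0 < lo ia
    show 0 < A₁
    exact hA₁0
  · -- WindowOK
    show ContinuousOn (fun A : ℝ => (((-Real.log (1 - (((-Real.log ε) / 2 + Real.log (A / 8)) + 11 / 5) / A)) + (250 + 16 * Real.log A) / A) + (-(1 / lam ^ (4 / 5 : ℝ)) * Real.log (1 - lam ^ (4 / 5 : ℝ) * ((-Real.log ε) / 2 - Real.log (lam ^ (1 / 5 : ℝ)) - 28 * Real.log A - 449) / (lam * (A - ((-Real.log ε) / 2 + Real.log (A / 8)) + 903 + 50 * Real.log A)))))) (Set.Icc A₁ A₂) ∧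
      ContinuousOn (fun A : ℝ => (((-Real.log (1 - (((-Real.log ε) / 2 + Real.log (A / 8)) + 11 / 5) / A)) + (250 + 16 * Real.log A) / A) + (-(1 / lam ^ (4 / 5 : ℝ)) * Real.log (1 - lam ^ (4 / 5 : ℝ) * ((-Real.log ε) / 2 - Real.log (lam ^ (1 / 5 : ℝ)) + 73) / (lam * (A - ((-Real.log ε) / 2 + Real.log (A / 8)) - 903 - 50 * Real.log A)))))) (Set.Icc A₁ A₂) ∧ 0 < 250 / A₂ ∧
      ∀ A ∈ Set.Icc A₁ A₂, 250 / A₂ ≤ (((-Real.log (1 - (((-Real.log ε) / 2 + Real.log (A / 8)) + 11 / 5) / A)) + (250 + 16 * Real.log A) / A) + (-(1 / lam ^ (4 / 5 : ℝ)) * Real.log (1 - lam ^ (4 / 5 : ℝ) * ((-Real.log ε) / 2 - Real.log (lam ^ (1 / 5 : ℝ)) - 28 * Real.log A - 449) / (lam * (A - ((-Real.log ε) / 2 + Real.log (A / 8)) + 903 + 50 * Real.log A))))) ∧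
        (((-Real.log (1 - (((-Real.log ε) / 2 + Real.log (A / 8)) + 11 / 5) / A)) + (250 + 16 * Real.log A) / A) + (-(1 / lam ^ (4 / 5 : ℝ)) * Real.log (1 - lam ^ (4 / 5 : ℝ) * ((-Real.log ε) / 2 - Real.log (lam ^ (1 / 5 : ℝ)) - 28 * Real.log A - 449) / (lam * (A - ((-Real.log ε) / 2 + Real.log (A / 8)) + 903 + 50 * Real.log A))))) ≤ (((-Real.log (1 - (((-Real.log ε) / 2 + Real.log (A / 8)) + 11 / 5) / A)) + (250 + 16 * Real.log A) / A) + (-(1 / lam ^ (4 / 5 : ℝ)) * Real.log (1 - lam ^ (4 / 5 : ℝ) * ((-Real.log ε) / 2 - Real.log (lam ^ (1 / 5 : ℝ)) + 73) / (lam * (A - ((-Real.log ε) / 2 + Real.log (A / 8)) - 903 - 50 * Real.log A))))) ∧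
        (((-Real.log (1 - (((-Real.log ε) / 2 + Real.log (A / 8)) + 11 / 5) / A)) + (250 + 16 * Real.log A) / A) + (-(1 / lam ^ (4 / 5 : ℝ)) * Real.log (1 - lam ^ (4 / 5 : ℝ) * ((-Real.log ε) / 2 - Real.log (lam ^ (1 / 5 : ℝ)) + 73) / (lam * (A - ((-Real.log ε) / 2 + Real.log (A / 8)) - 903 - 50 * Real.log A))))) ≤ Tmax
    exact ⟨hc1, hc2, hTmin, hchain⟩
  · -- CoveringHyp
    intro L hL x hx _htr
    obtain ⟨hbox0, hboxQ⟩ := hx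
    refine ⟨?_, ?_⟩
    · -- (0) a-priori bound
      intro T' Z hT' hT'le hZ
      obtain ⟨hinit, hzero, hode⟩ := hZ
      obtain ⟨hz', hcont', hder'⟩ := clockBox_sol ε lam T' L Z _ rfl hzero hode
      obtain ⟨-, d0, d1, d2, d3, d4, d5, d6, d7, d8, d9, d10⟩ := clockBox_data lam (lam ^ (-(4 / 5 : ℝ))) ε A₁ A₂ Tmax x Z hbox0 hboxQ hinit
      have hB := toda_boot lam (lam ^ (4 / 5 : ℝ)) (lam ^ (1 / 5 : ℝ)) (lam ^ (-(4 / 5 : ℝ))) ε (-Real.log ε) As A₁ A₂ Tmax hlam1 hlam32 rfl rfl rfl hε rfl hAs hA₁ hA₂ h4 hbig hTmax hε5 hs2 hs3 hs5 hsσ hs6 hs7 L (x 0 0) T' (Z 0) (Z 1) hL hT' hT'le d0 d1 d2 d3 d4 d5 d6 d7 d8 d9 d10 hz' hcont' hder'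
      intro i n t ht
      obtain ⟨-, -, -, hw⟩ := hB t ht
      rcases fin_two_eq_zero_or_one i with rfl | rfl
      · exact (hw n).1
      · exact (hw n).2
    · -- INTO / COVER / PHASE
      intro Z hZ
      obtain ⟨hinit, hzero, hode⟩ := hZ
      obtain ⟨hz', hcont', hder'⟩ := clockBox_sol ε lam Tmax L Z _ rfl hzero hode
      obtain ⟨hx1, d0, d1, d2, d3, d4, d5, d6, d7, d8, d9, d10⟩ := clockBox_data lam (lam ^ (-(4 / 5 : ℝ))) ε A₁ A₂ Tmax x Z hbox0 hboxQ hinit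
      have hB := toda_boot lam (lam ^ (4 / 5 : ℝ)) (lam ^ (1 / 5 : ℝ)) (lam ^ (-(4 / 5 : ℝ))) ε (-Real.log ε) As A₁ A₂ Tmax hlam1 hlam32 rfl rfl rfl hε rfl hAs hA₁ hA₂ h4 hbig hTmax hε5 hs2 hs3 hs5 hsσ hs6 hs7 L (x 0 0) Tmax (Z 0) (Z 1) hL hTmax0 le_rfl d0 d1 d2 d3 d4 d5 d6 d7 d8 d9 d10 hz' hcont' hder'
      have hcorr : ∀ t ∈ Set.Icc 0 Tmax, Z 1 1 t ≤ 1 / 4 ∧ Z 1 (-1) t ≤ 1 ∧ |Z 0 2 t| ≤ 1 :=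
        fun t ht => ⟨(hB t ht).1, (hB t ht).2.1, (hB t ht).2.2.1⟩
      have hA : x 0 0 ∈ Set.Icc A₁ A₂ := ⟨d1, d2⟩
      obtain ⟨hA4, hΛA, hεA, hsqA, -, -, hDm, -⟩ := hpt (x 0 0) hA
      obtain ⟨cu, cv, cw, cz, ce, cy, ou, ov, ow, oz⟩ :=
        toda_boot_sys lam (lam ^ (4 / 5 : ℝ)) ε Tmax L (Z 0) (Z 1) rfl hL hcont' hder'
      have hbnn := (toda_trunc_structure lam ε Tmax L (Z 0) (Z 1) (by linarith) hε.le hTmax0 hz' hcont'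
        hder' d8).1
      have ht3 : ((-Real.log (1 - (((-Real.log ε) / 2 + Real.log ((x 0 0) / 8)) + 11 / 5) / (x 0 0))) + (250 + 16 * Real.log (x 0 0)) / (x 0 0)) ≤ Tmax := by
        have h := hchain (x 0 0) hA
        linarith [h.2.1, h.2.2, hDm]
      have hzs := toda_active_zsup lam (lam ^ (4 / 5 : ℝ)) ε (x 0 0) Tmax (Z 0 0) (Z 1 0) (Z 0 1) (Z 1 1)
        (Z 1 (-1)) (Z 0 2) hlam1 hlam32 rfl hε hTmax0 (by linarith) hA4 hΛA hεA hsqA ht3 d0 d3 d4 d5 d6 d7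
        cu cv cw cz ce cy ou ov ow oz (fun t ht => ⟨hbnn (-1) t ht, (hcorr t ht).2.1⟩)
        (fun t ht => (hcorr t ht).2.2) (fun t ht => by linarith [(hcorr t ht).1])
      have hI := toda_into lam (lam ^ (4 / 5 : ℝ)) (lam ^ (1 / 5 : ℝ)) (lam ^ (-(4 / 5 : ℝ))) ε (-Real.log ε) As A₁ A₂ Tmax hlam1 hlam32 rfl rfl rfl hε rfl hAs hA₁ hA₂ h4 hbig hTmax hε5 hs2 hs3 hs5 hsσ hs6 hs7 L (x 0 0) (Z 0) (Z 1) hL d0 d1 d2 d3 d4 d5 d6 d7 d8 d9 d10 hz' hcont' hder' hcorr hzs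
      have hC := toda_cover lam (lam ^ (4 / 5 : ℝ)) (lam ^ (1 / 5 : ℝ)) (lam ^ (-(4 / 5 : ℝ))) ε (-Real.log ε) As A₁ A₂ Tmax hlam1 hlam32 rfl rfl rfl hε rfl hAs hA₁ hA₂ h4 hbig hTmax hε5 L (x 0 0) (Z 0) (Z 1) hL d0 d1 d2 d3 d4 d5 d6 d7 d8 d9 d10 hz' hcont' hder' hcorr hzs
      refine ⟨fun T hT => ⟨fun n hn0 hnL => ?_, fun i hi0 hi1 => ?_⟩, ?_, ?_⟩
      · -- INTO
        obtain ⟨htr, h2, hpr⟩ := hI T hT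
        rcases lt_trichotomy n 0 with hn | rfl | hn
        · obtain ⟨ha, hb0, hb1⟩ := htr n (by omega) (by have := abs_le.1 hnL; omega)
          simp only [hn, ↓reduceIte, Set.mem_setOf_eq]
          exact ⟨(abs_le.1 ha).1, (abs_le.1 ha).2, hb0, hb1⟩
        · exact absurd rfl hn0
        · by_cases hn1 : n = 1
          · subst hn1
            simp only [show ¬ ((1 : ℤ) < 0) from by norm_num, ↓reduceIte, Set.mem_setOf_eq, Int.reduceAdd]
            exact h2
          · obtain ⟨ha, hb0, hb1⟩ := hpr n (by omega) (by have := abs_le.1 hnL; omega)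
            simp only [show ¬ (n < 0) from by omega, hn1, ↓reduceIte, Set.mem_setOf_eq]
            exact ⟨by linarith [(abs_le.1 ha).1], (abs_le.1 ha).2, hb0, hb1⟩
      · -- no third species
        rcases fin_two_eq_zero_or_one i with h | h
        · exact absurd h hi0
        · exact absurd h hi1
      · -- COVER
        intro T hT hph
        show (x 0 0 = A₁ → lam ^ (1 / 5 : ℝ) * Z 0 1 T < A₁) ∧ (x 0 0 = A₂ → A₂ < lam ^ (1 / 5 : ℝ) * Z 0 1 T)
        rw [hx1] at hph
        exact hC.1 T hT hph
      · -- PHASE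
        rw [hx1]
        exact hC.2

end Summit.NavierStokesRegularity.NavierStokesRegularity.Theorems.PerpetualPumpCircuitPump
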